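import Summits.RiemannHypothesis.RiemannHypothesis.Theorems.HandoffDodgerSlabFiveCeiling
import Summits.RiemannHypothesis.RiemannHypothesis.Theorems.HandoffDodgerSlabFourFamily
import HarnessLib

/-!
# HANDOFF — THE RH-FREE ZERO-SUM FAMILY, WALL CEILING AND UPPER CLAUSE FROM `q₀ = 1015` (rh-explicit, W-P(P2) crux 19172 / 19185, seat dodger-p2 gen0; DODGER-STAGE2-PLAN §2 (c))

RH-FREE. HONEST FRAMING: nothing here bears on the truth of RH; every statement is an UPPER bound on the wall offsets
`δ*(q) = a*(S_q) − (log q)/2` or an upper clause `a*(S_q) < (log q')/2` (RH is the LOWER clause `∀ q, 0 ≤ δ*(q)`, not touched).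

The glue of this seat's fifth slab `[1015, 7100)` (`HandoffDodgerSlabFiveCeiling.subwindowZeroSum_slabFive`, on the COUNTING witness
`dodger_witness_explicit_window_counting`) with the family from `7100` (`HandoffDodgerSlabFourFamily.subwindowZeroSumFamily_sevenThousandOneHundred`):
* `subwindowZeroSumFamily_oneThousandFifteen : SubwindowZeroSumFamily (1/5) 1015`;
* `dodgerWallCeiling_oneThousandFifteen : DodgerWallCeiling (1/5) 1015`;
* **`upperClause_from_oneThousandFifteen`** — the UPPER CLAUSE `a*(S_q) < (log q⁺)/2` for EVERY prime `q ≥ 1015`, GAP-BLIND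
  (all but 23 of the lower-twin primes of the WEIL route's wall `WallsTenKTwin`, stmt 19172: the twins `157 ≤ q < 1015` remain for tier 2);
* `classLaw_from_oneThousandFifteen` and the `iff_range` reductions of the route's crux to the primes `q < 1015`.
No `sorry`, standard axioms; every ingredient is a theorem of this track or of Mathlib.

References: this track (ATTEMPT-16, ATTEMPT-19 §7–§8, ATTEMPT-21, ATTEMPT-23; HOME/rh-explicit-dodger-p2/DODGER-STAGE2-PLAN.md §2).
-/

set_option linter.dupNamespace false

noncomputable section

open Real Complex Set MeasureTheory Literature.NumberTheory.LFunctions Literature.NumberTheory.LFunctions.WeilContinuous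

namespace Summit.RiemannHypothesis.RiemannHypothesis.Theorems.Handoff

open Summit.RiemannHypothesis.RiemannHypothesis.Theorems.MotivicDoor.SemilocalThreshold
open Summit.RiemannHypothesis.RiemannHypothesis.Theorems.HandoffDecomposition (nextPrime nextPrime_prime lt_nextPrime nextPrime_le consecutivePrimes_nextPrime)
open Summit.RiemannHypothesis.RiemannHypothesis.Theorems.SemilocalClassLaw

/-- **THEOREM (the RH-free zero-sum family at rate `(1/5)(log q)^{3/2}q^{−3/2}` from `q₀ = 1015` on)** — this seat's fifth slab glued with
the family from `7100` (`HandoffDodgerSlabFourFamily`). [this track, ATTEMPT-16 THEOREM 16.2; ATTEMPT-23 §7; DODGER-STAGE2-PLAN §2] -/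
theorem subwindowZeroSumFamily_oneThousandFifteen : SubwindowZeroSumFamily (1 / 5) 1015 := by
  intro q q' hqq' hq₀
  rcases Nat.lt_or_ge q 7100 with hlt | hge
  · exact subwindowZeroSum_slabFive hqq' hq₀ hlt
  · exact subwindowZeroSumFamily_sevenThousandOneHundred q q' hqq' hge

/-- **COROLLARY (the Dodger wall ceiling from `1015`, RH-free).** `∀ primes q ≥ 1015, δ*(q) ≤ (1/5)(log q)^{3/2} q^{−3/2}`.
[this track, DODGER-STAGE2-PLAN §2] -/
theorem dodgerWallCeiling_oneThousandFifteen : DodgerWallCeiling (1 / 5) 1015 :=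
  dodgerWallCeiling_of_zeroSumFamily subwindowZeroSumFamily_oneThousandFifteen

/-- **COROLLARY (the RH-free UPPER CLAUSE from `q₀ = 1015`, GAP-BLIND).** For every prime `q ≥ 1015`:
`a*(S_{<q}) < (log q⁺)/2`, `q⁺` the next prime — in particular at every lower-twin prime `q ≥ 1015` of the WEIL route's wall
`WallsTenKTwin` (stmt 19172). [this track, DODGER-STAGE2-PLAN §2] -/
theorem upperClause_from_oneThousandFifteen {q : ℕ} (hq : q.Prime) (hq₀ : 1015 ≤ q) :
    weilSemilocalThreshold (Nat.primesBelow q) < Real.log (nextPrime q) / 2 := by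
  have hqq' := consecutivePrimes_nextPrime hq
  obtain ⟨θ, δ, hθ, hθs, hδ, -, hwin, hneg⟩ :=
    subwindowWitnessFamily_of_zeroSumFamily subwindowZeroSumFamily_oneThousandFifteen q (nextPrime q) hqq' hq₀
  have h := wallOffset_lt_of_translatePair hqq' hθ hθs hδ hwin hneg
  simp only [HandoffMarginLaw.wallOffset] at h
  linarith

/-- C-I(a) at every prime `q ≥ 1015`, in the `∀ q' > q` currency of the WEIL route's leaf (the sentence of `WallsTenKTwin`, stmt 19172,
at every prime `q ≥ 1015`, twin or not). [this track, DODGER-STAGE2-PLAN §2] -/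
theorem classLaw_from_oneThousandFifteen {q : ℕ} (hq : q.Prime) (hq₀ : 1015 ≤ q) :
    ∀ q' : ℕ, q'.Prime → q < q' → weilSemilocalThreshold (Nat.primesBelow q) < Real.log q' / 2 :=
  forall_prime_gt_lt_iff_upperClause.2 (upperClause_from_oneThousandFifteen hq hq₀)

/-- **THE WEIL ROUTE'S CRUX REDUCED TO `q < 1015` (RH-free bookkeeping).** `SemilocalClassLawTail` (C-I(a) for all primes `q ≥ 80`)
holds iff the upper clause holds at the primes `80 ≤ q < 1015`. [this track, DODGER-STAGE2-PLAN §2] -/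
theorem semilocalClassLawTail_iff_range_oneThousandFifteen :
    SemilocalClassLawTail ↔
      ∀ q : ℕ, q.Prime → 80 ≤ q → q < 1015 →
        weilSemilocalThreshold (Nat.primesBelow q) < Real.log (nextPrime q) / 2 := by
  rw [semilocalClassLawTail_iff_forall_upperClause]
  refine ⟨fun h q hq h80 _ ↦ h q hq h80, fun h q hq h80 ↦ ?_⟩
  rcases Nat.lt_or_ge q 1015 with hlt | hge
  · exact h q hq h80 hlt
  · exact upperClause_from_oneThousandFifteen hq hge

/-- The whole leaf likewise: `SemilocalClassLawAll` iff the upper clause at every prime `q < 1015`. [this track, DODGER-STAGE2-PLAN §2] -/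
theorem semilocalClassLawAll_iff_upperClause_range_oneThousandFifteen :
    SemilocalClassLawAll ↔
      ∀ q : ℕ, q.Prime → q < 1015 → weilSemilocalThreshold (Nat.primesBelow q) < Real.log (nextPrime q) / 2 := by
  rw [semilocalClassLawAll_iff_forall_upperClause]
  refine ⟨fun h q hq _ ↦ h q hq, fun h q hq ↦ ?_⟩
  rcases Nat.lt_or_ge q 1015 with hlt | hge
  · exact h q hq hlt
  · exact upperClause_from_oneThousandFifteen hq hge

end Summit.RiemannHypothesis.RiemannHypothesis.Theorems.Handoff

end
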